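import Summits.QuantumFields.YangMills.Theorems.BalabanUVNodesN15KingModelSlicesTelescoped
import HarnessLib

/-!
# BalabanUVNodes ∕ N15 — THE KING-MODEL RUNG, CURVED EDITION (PART Χ-g, PACKAGE): KING 1986 §2 (2.17) AND §3.3 PROPOSITIONS 3.7 ∕ 3.9 **AT `A = 0`, BY NAME,
# IN ONE STATEMENT** for the two-spacing datum `T = kingSlicesTwoSpacing L k n e_M M a m²` — `Prop37KingOrder T.lo` (the `k`-level run), `Prop37KingOrder` of the
# `(k+n)`-level run, `Prop39KingOrder T`, and the EXACT slice decompositions `Σ_{j<k} G^η_{(j)} = G^η_k`, `Σ_{j<k} G^{η′}_{(j)} + Σ_{i<n} G^{η′}_{(i−n)} = G^{η′}_{k+n}`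
# of the two full `A = 0` propagators ([Ba 4] (1.6) `G_k(T_ε, 0)`) — THE citable name for consumers and referees
# (Track A, DAG node N15 = NE2; FAN-OUT v1.1 §N15 s3 «KING-MODEL RUNG»)

HONEST FRAMING.  Count-neutral (cell `pub-ymgap`, seat `pub-ymgap-dag-n15-e` g18; `--supports stmt-QuantumFields-27366 --as helper` = K3⁸
`SpineGivenEndpointR13SepCoPHV`).  TEMPLATE LITERATURE, `A = 0`: C. King's scalar U(1)-Higgs MODEL on finite tori ([King1986] (2.17) p. 653, Prop. 3.7 p. 663,
Prop. 3.9 p. 665 — PRINTED and proved there; here decided for the tree's objects at `A = 0`, `Ω = T_η`, King's quantifier order «0 < α < 1» first);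
NOT Bałaban's covariant objects; NE2⁺ is NOT PRINTED for those and not proved; NOT a node discharge; nothing continuum ∕ ℝ⁴ ∕ OS ∕ mass-gap ∕ Clay.
0 `sorry`, 0 `def`; standard axioms.  ASSEMBLY ONLY of: part Ρ-g `prop37KingOrder_king_zeroField` (at `k` and at `k + n`), part Χ-d
`prop39KingOrder_king_zeroField`, part Χ-e `sum_kingSliceG_eq_constrainedProp` ∕ `sum_hiG_add_finest_eq`.
HONEST SCOPE: `A = 0`, periodic b.c., odd `L ≥ 3`, `a > 0`, `k, n ≥ 1`, cube `2L^{e_M}`, `0 < m² ≤ m₀²`; (3.64)∕(3.74) EMPTY BY TYPE (`B = PEmpty`: the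
vector field's contour kernels are absent in the scalar model); the family-uniform schemas `Prop37Printed`∕`Prop39Printed` (α INSIDE one constant) are
NOT claimed (the model's (3.65)₂ constant and (3.75) rate depend on `α`); Prop. 3.8 (the minimiser's lines (3.71)) is dag-n15-d's `Prop38KingOrder`
inhabitant on its own datum, not a conjunct here.  WHAT THE CURVED CASE ADDS (one line): the same four statements for `G_(j)(Ω, A)`, `G^ε_k(Ω, A)`,
regular `A ≠ 0` (Def. 3.2), `Ω ⊊ T_η`, with the contour clauses — [King1986] §4 ∕ [Ba 4], not in the model.
Locators: [King1986] (2.13)–(2.17) p.653, (2.20) p.654, Prop. 3.7 (3.63)–(3.65) p.663, p.664 (pairing), Prop. 3.9 (3.73)–(3.75) p.665, (4.42)–(4.43) p.675.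
-/

noncomputable section

namespace Summit.QuantumFields.YangMills.BalabanUVNodes.N15KingModelRung.Curved

open Real Finset Matrix
open Literature.MathematicalPhysics.QuantumFieldTheory.Balaban1983to89.B5Prop11Plancherel (Tor fine unitVec)
open Literature.MathematicalPhysics.QuantumFieldTheory.King1986 (aK)
open Literature.MathematicalPhysics.QuantumFieldTheory.King1986.Torus (constrainedProp)
open Literature.MathematicalPhysics.QuantumFieldTheory.King1986.SlicePropagator (Prop37KingOrder Prop39KingOrder)

variable {d : ℕ} (L : ℕ) [NeZero L]

/-- ★★★ **KING 1986 (2.17) + PROPOSITIONS 3.7 ∕ 3.9 AT `A = 0`, BY NAME, ONE STATEMENT**: for odd `L ≥ 3`, `a > 0`, `k, n ≥ 1`, a cube `M_ν = 2L^{e_M}`, a mass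
`0 < m² ≤ m₀²`, and the two-spacing datum `T = kingSlicesTwoSpacing L k n e_M M a m²` (part Χ-a): (i) `Prop37KingOrder T.lo` — Prop. 3.7 for the `k`-level
run's slices; (ii) `Prop37KingOrder` for the `(k+n)`-level run's slices (all `−n ≤ j ≤ k − 1` in King's indexing); (iii) `Prop39KingOrder T` — Prop. 3.9 for
the pair; (iv) `Σ_{j<k} G^η_{(j)}(x, y) = G^η_k(x, y)` EXACTLY; (v) `Σ_{j<k} G^{η′}_{(j)}(x′, y′) + Σ_{i<n} G^{η′}_{(i−n)}(x′, y′) = G^{η′}_{k+n}(x′, y′)` EXACTLY —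
the propagators being King's∕Bałaban's `constrainedProp (L^k) M a_k (L^k)² m²` and `constrainedProp (L^{k+n}) M a_{k+n} (L^{k+n})² m²`.
[cite: King1986, (2.17) p.653, Prop. 3.7 (3.63)–(3.65) p.663, Prop. 3.9 (3.73)–(3.75) p.665] -/
theorem king_slices_props37_39_and_217_at_zeroField (hLodd : Odd L) (hL : 2 ≤ L) {a : ℝ} (ha : 0 < a) {m0sq : ℝ} (hm0 : 0 ≤ m0sq)
    {k n : ℕ} (hk : 1 ≤ k) (hn : 1 ≤ n) (eM : ℕ) (M : Fin (d + 1) → ℕ) [∀ μ, NeZero (M μ)] (hM : ∀ μ, M μ = 2 * L ^ eM)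
    {msq : ℝ} (hmsq : 0 < msq) (hcap : msq ≤ m0sq) :
    Prop37KingOrder (kingSlicesTwoSpacing L k n eM M hM hk a msq).lo ∧
      Prop37KingOrder (kingSliceKernels L (k + n) eM M hM (one_le_add_of_one_le hk n) a msq) ∧
      Prop39KingOrder (kingSlicesTwoSpacing L k n eM M hM hk a msq) ∧
      (∀ x y : Tor (fine (L ^ k) M),
        ∑ j ∈ Finset.range k, (kingSlicesTwoSpacing L k n eM M hM hk a msq).lo.G j x y
          = constrainedProp (L ^ k) M (aK a L k) (((L ^ k : ℕ) : ℝ) ^ 2) msq x y) ∧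
      (∀ x' y' : Tor (fine (L ^ (k + n)) M),
        ∑ j ∈ Finset.range k, (kingSlicesTwoSpacing L k n eM M hM hk a msq).hi.G j x' y'
            + ∑ i ∈ Finset.range n, (kingSliceKernels L (k + n) eM M hM (one_le_add_of_one_le hk n) a msq).G i x' y'
          = constrainedProp (L ^ (k + n)) M (aK a L (k + n)) (((L ^ (k + n) : ℕ) : ℝ) ^ 2) msq x' y') :=
  ⟨prop37KingOrder_king_zeroField L hLodd hL ha hm0 hk eM M hM hmsq hcap,
    prop37KingOrder_king_zeroField L hLodd hL ha hm0 (one_le_add_of_one_le hk n) eM M hM hmsq hcap,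
    prop39KingOrder_king_zeroField L hLodd hL ha hm0 hk hn eM M hM hmsq hcap,
    fun x y => sum_kingSliceG_eq_constrainedProp L hL ha k hk eM M hM hmsq x y,
    fun x' y' => sum_hiG_add_finest_eq L hL ha hk M hM hmsq x' y'⟩

end Summit.QuantumFields.YangMills.BalabanUVNodes.N15KingModelRung.Curved

end
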